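/-
Copyright (c) 2026 the pub-hodgecm-mathlib formalisation cell (harness21).  Prover seat hodgecm-mathlib-K2E1-p14 (g0), Track B «K2-LIT» ENGINE E1, h413 =
`stmt-HodgeConjecture-24833`, route `HCCMUnconditional`, campaign «5Res» — the topology step «(E3) + realness ⇒ `hs`» of the (SD) MS entry letters (census 12:54Z).
-/
import Mathlib
import Summits.HodgeConjecture.HodgeConjecture.Theorems.K2E1ChiUnitaryAxisContinuationCMTwo   -- ★ p860080 (K2E1-p13): `analyticAt_of_re_eq_half_of_fe_of_conj` (no true pole on the unitary axis)
import HarnessLib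

/-!
# h413 ∕ Track B «K2-LIT», 5Res — `K2E1MeromorphicStripFinitePoles`: A CLOSED CO-DISCRETE POLE SET WHOSE POINTS IN A CLOSED VERTICAL STRIP ARE REAL MEETS THE STRIP IN A FINITE SET OF
# REAL POINTS, OFF WHICH AN OPEN NEIGHBOURHOOD OF THE STRIP AVOIDS THE POLE SET — the passage from the (b)-block export (E3) to the (SD) entry letter `hs`

Cell `pub/hodgecm-mathlib`, crux H413 = `stmt-HodgeConjecture-24833`; dealer K2E1-plan (g7) (237)∕census 12:54Z.  THEOREMS ONLY (no `def`, no `instance`, no `notation`, no named-fact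
hypothesis, no `sorry`); lane `--kind proof --supports stmt-HodgeConjecture-24833 --as helper` (count-neutral).  Mathlib only.

THE MATHEMATICS (point-set topology, folklore).  Let `P ⊆ ℂ` be closed with punctured neighbourhoods avoiding it (`∀ z₀, ∀ᶠ s in 𝓝[≠] z₀, s ∉ P` — the shape of ★ X2∕X2_χ's export (E3)),
and suppose every point of `P` in the closed strip `{σ₁ ≤ Re ≤ σ₀}` is REAL with `σ₁ < Re < σ₀` (the (d)-block's «no complex ∕ no boundary poles»).  Then: `P ∩ strip` is a FINITE set
`S` of reals in `(σ₁, σ₀)` (a co-discrete set meets the compact segment `[σ₁, σ₀] ⊂ ℝ ⊂ ℂ` finitely: `IsCompact.elim_nhds_subcover`), `U := (P ∖ S)ᶜ` is OPEN (the points of `S` are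
isolated in `P`), contains the strip, and `U ∖ S ⊆ Pᶜ`; consequently any `f` analytic off `P` is holomorphic on `U ∖ S` — the letter `hs` of ★ `exists_linearIsometry_selfDual_of_letters` ∕
★ `K2E1PseudoEisensteinContourShiftVector` for every entry `z ↦ ⟪φ_b, M(z)φ_a⟫` (a linear combination of the scattering coordinates `qc_j` of ★ X2_χ (A)∕M1 print).
HONEST LABEL: HC_CM is proved only modulo the 7 printed citations (2 remaining named inputs: hLiu418 = `stmt-HodgeConjecture-24832`, h413 = `stmt-HodgeConjecture-24833`) until rung 0
closes; count-neutral helper, closes no socket.  P′-SHRINK (K2E1-p13 ∕ dealer (241)): §3 states everything for the TRUE singular set `P′ = {z | ¬ AnalyticAt ℂ f z}` of an `f`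
analytic off a co-discrete `P` (realness is asked only of genuine poles), and §4 adds the axis clause of ★ p860080 (`Re z = ½` is pole-free under (FE) + (conj)).

## References
* [MoeglinWaldspurger1995] C. Mœglin, J.-L. Waldspurger, *Spectral Decomposition and Eisenstein Series* (1995), IV.1.11 (finiteness of the singular hyperplanes meeting a compact set).
* [BernsteinLapid2019] J. Bernstein, E. Lapid, *On the meromorphic continuation of Eisenstein series*, J. Amer. Math. Soc. 37 (2024) (arXiv:1911.02342), §2.1.
-/

set_option autoImplicit false
-- the mandated namespace repeats `HodgeConjecture.HodgeConjecture`, as in every `Theorems/*.lean` of this sub-problem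
set_option linter.dupNamespace false

noncomputable section

open Filter Topology Set
open scoped ComplexConjugate
open Summit.HodgeConjecture.HodgeConjecture.Cruxes.H413.K2E1ChiUnitaryAxisContinuationCMTwo (analyticAt_of_re_eq_half_of_fe_of_conj)

namespace Summit.HodgeConjecture.HodgeConjecture.Cruxes.H413.K2E1MeromorphicStripFinitePoles

/-- **A CO-DISCRETE SET MEETS A COMPACT SET IN A FINITE SET** (punctured neighbourhoods avoiding `P`; `IsCompact.elim_nhds_subcover`). [folklore] -/
theorem finite_inter_of_coDiscrete {X : Type*} [TopologicalSpace X] {P K : Set X} (hPcd : ∀ x : X, ∀ᶠ s in 𝓝[≠] x, s ∉ P) (hK : IsCompact K) : (P ∩ K).Finite := by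
  classical
  have hU : ∀ x ∈ K, {s : X | s ≠ x → s ∉ P} ∈ 𝓝 x := fun x _ => eventually_nhdsWithin_iff.1 (hPcd x)
  obtain ⟨t, -, hcover⟩ := hK.elim_nhds_subcover (fun x => {s : X | s ≠ x → s ∉ P}) hU
  refine t.finite_toSet.subset fun p hp => ?_
  obtain ⟨x, hxt, hpx⟩ := Set.mem_iUnion₂.1 (hcover hp.2)
  by_contra hpt
  exact hpx (fun h => hpt (h ▸ hxt)) hp.1

/-- **THE POLES IN A CLOSED STRIP: FINITELY MANY, REAL, WITH AN OPEN NEIGHBOURHOOD OF THE STRIP OFF THEM AVOIDING `P`.**  For `P ⊆ ℂ` closed and co-discrete whose points in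
`{σ₁ ≤ Re ≤ σ₀}` are real with `σ₁ < Re < σ₀`: a finset `S ⊂ (σ₁, σ₀)` of reals, all in `P`, containing (the real parts of) every point of `P` in the strip, with `U := (P ∖ ↑S)ᶜ` OPEN,
`strip ⊆ U` and `U ∖ ↑S ⊆ Pᶜ`. [folklore] [cite: MoeglinWaldspurger1995, IV.1.11] -/
theorem exists_finset_real_poles_strip {P : Set ℂ} (hPc : IsClosed P) (hPcd : ∀ z₀ : ℂ, ∀ᶠ s in 𝓝[≠] z₀, s ∉ P) {σ₁ σ₀ : ℝ}
    (hreal : ∀ z ∈ P, σ₁ ≤ z.re → z.re ≤ σ₀ → z.im = 0 ∧ σ₁ < z.re ∧ z.re < σ₀) :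
    ∃ S : Finset ℝ, (∀ c ∈ S, (c : ℂ) ∈ P ∧ σ₁ < c ∧ c < σ₀) ∧
      (∀ z ∈ P, σ₁ ≤ z.re → z.re ≤ σ₀ → z.re ∈ S ∧ z = (z.re : ℂ)) ∧
      IsOpen (P \ ((S.image fun c : ℝ => (c : ℂ)) : Set ℂ))ᶜ ∧
      {z : ℂ | σ₁ ≤ z.re ∧ z.re ≤ σ₀} ⊆ (P \ ((S.image fun c : ℝ => (c : ℂ)) : Set ℂ))ᶜ ∧
      (P \ ((S.image fun c : ℝ => (c : ℂ)) : Set ℂ))ᶜ \ ((S.image fun c : ℝ => (c : ℂ)) : Set ℂ) ⊆ Pᶜ := by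
  classical
  -- the compact real segment `[σ₁, σ₀] ⊂ ℂ` and the finite set `P ∩ segment`
  have hK : IsCompact ((fun c : ℝ => (c : ℂ)) '' Icc σ₁ σ₀) := isCompact_Icc.image Complex.continuous_ofReal
  have hfin := finite_inter_of_coDiscrete hPcd hK
  obtain ⟨S, hS⟩ : ∃ S : Finset ℝ, S = hfin.toFinset.image Complex.re := ⟨_, rfl⟩
  -- every point of `P` in the strip is a real point of the segment
  have hstrip : ∀ z ∈ P, σ₁ ≤ z.re → z.re ≤ σ₀ → z = (z.re : ℂ) ∧ z ∈ P ∩ (fun c : ℝ => (c : ℂ)) '' Icc σ₁ σ₀ := fun z hz h1 h2 => by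
    have him := (hreal z hz h1 h2).1
    have hz' : z = (z.re : ℂ) := Complex.ext (by simp) (by simp [him])
    exact ⟨hz', hz, z.re, ⟨h1, h2⟩, hz'.symm⟩
  have hmemS : ∀ z ∈ P, σ₁ ≤ z.re → z.re ≤ σ₀ → z.re ∈ S := fun z hz h1 h2 => by
    rw [hS, Finset.mem_image]
    exact ⟨z, hfin.mem_toFinset.2 (hstrip z hz h1 h2).2, rfl⟩
  have hSP : ∀ c ∈ S, (c : ℂ) ∈ P ∧ σ₁ < c ∧ c < σ₀ := fun c hc => by
    rw [hS, Finset.mem_image] at hc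
    obtain ⟨w, hw, rfl⟩ := hc
    obtain ⟨hwP, c', hc', hc'w⟩ := hfin.mem_toFinset.1 hw
    have hre : w.re = c' := by rw [← hc'w, Complex.ofReal_re]
    have h := hreal w hwP (hre ▸ hc'.1) (hre ▸ hc'.2)
    refine ⟨?_, h.2.1, h.2.2⟩
    have e : ((c' : ℝ) : ℂ) = w := hc'w
    rw [hre, e]; exact hwP
  -- the image of `S` in `ℂ`
  have hS' : ∀ z : ℂ, z ∈ ((S.image fun c : ℝ => (c : ℂ)) : Set ℂ) ↔ ∃ c ∈ S, (c : ℂ) = z := fun z => by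
    rw [Finset.coe_image]; exact ⟨fun ⟨c, hc, h⟩ => ⟨c, hc, h⟩, fun ⟨c, hc, h⟩ => ⟨c, hc, h⟩⟩
  refine ⟨S, hSP, fun z hz h1 h2 => ⟨hmemS z hz h1 h2, (hstrip z hz h1 h2).1⟩, ?_, fun z hz => ?_, fun z hz => ?_⟩
  · -- openness: off `P` use `Pᶜ ∈ 𝓝`; at a point of `S` use the punctured neighbourhood avoiding `P`
    rw [isOpen_iff_mem_nhds]
    intro x hx
    rw [Set.mem_compl_iff, Set.mem_sdiff, not_and, not_not] at hx
    by_cases hxP : x ∈ P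
    · have hev : ∀ᶠ s in 𝓝 x, s ≠ x → s ∉ P := eventually_nhdsWithin_iff.1 (hPcd x)
      filter_upwards [hev] with s hs
      rw [Set.mem_compl_iff, Set.mem_sdiff, not_and, not_not]
      intro hsP
      by_cases hsx : s = x
      · rw [hsx]; exact hx hxP
      · exact absurd hsP (hs hsx)
    · filter_upwards [hPc.isOpen_compl.mem_nhds hxP] with s hs
      exact fun h => absurd h.1 hs
  · -- the strip lies in `U`
    rw [Set.mem_compl_iff, Set.mem_sdiff, not_and, not_not]
    intro hzP
    rw [hS' z]
    exact ⟨z.re, hmemS z hzP hz.1 hz.2, (hstrip z hzP hz.1 hz.2).1.symm⟩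
  · -- `U ∖ S ⊆ Pᶜ`
    intro hzP
    have h1 := hz.1
    rw [Set.mem_compl_iff, Set.mem_sdiff, not_and, not_not] at h1
    exact hz.2 (h1 hzP)

/-- **COROLLARY — THE ENTRY LETTER `hs`**: with `S`, `U` as above, any `f` analytic off `P` is holomorphic on `U ∖ ↑S`. [folklore] -/
theorem exists_finset_differentiableOn_strip {P : Set ℂ} (hPc : IsClosed P) (hPcd : ∀ z₀ : ℂ, ∀ᶠ s in 𝓝[≠] z₀, s ∉ P) {σ₁ σ₀ : ℝ}
    (hreal : ∀ z ∈ P, σ₁ ≤ z.re → z.re ≤ σ₀ → z.im = 0 ∧ σ₁ < z.re ∧ z.re < σ₀) :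
    ∃ (S : Finset ℝ) (U : Set ℂ), (∀ c ∈ S, (c : ℂ) ∈ P ∧ σ₁ < c ∧ c < σ₀) ∧ IsOpen U ∧ {z : ℂ | σ₁ ≤ z.re ∧ z.re ≤ σ₀} ⊆ U ∧
      U \ ((S.image fun c : ℝ => (c : ℂ)) : Set ℂ) ⊆ Pᶜ ∧
      ∀ {E : Type} [NormedAddCommGroup E] [NormedSpace ℂ E] (f : ℂ → E), (∀ z : ℂ, z ∉ P → AnalyticAt ℂ f z) →
        DifferentiableOn ℂ f (U \ ((S.image fun c : ℝ => (c : ℂ)) : Set ℂ)) := by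
  obtain ⟨S, hSP, -, hUo, hUs, hUP⟩ := exists_finset_real_poles_strip hPc hPcd hreal
  exact ⟨S, _, hSP, hUo, hUs, hUP, fun f hf z hz => (hf z (hUP hz)).differentiableAt.differentiableWithinAt⟩

/-! ## §3 The P′-shrink: the TRUE singular set of a function analytic off a co-discrete set -/

/-- **`hs` FROM THE TRUE SINGULAR SET** (P′-shrink): `f` analytic off a co-discrete `P`, and every NON-ANALYTIC point of `f` in the closed strip `{σ₁ ≤ Re ≤ σ₀}` real with `σ₁ < Re < σ₀`
⇒ a finset `S ⊂ (σ₁, σ₀)` of genuine real poles and an open `U ⊇ strip` with `f` holomorphic on `U ∖ ↑S` (§2 applied to `P′ = {z | ¬ AnalyticAt ℂ f z}`, closed by `isOpen_analyticAt`,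
co-discrete inside `P`). [folklore] [cite: MoeglinWaldspurger1995, IV.1.11] -/
theorem exists_finset_differentiableOn_strip_of_singular {E : Type} [NormedAddCommGroup E] [NormedSpace ℂ E] [CompleteSpace E] {f : ℂ → E} {P : Set ℂ}
    (hPcd : ∀ z₀ : ℂ, ∀ᶠ s in 𝓝[≠] z₀, s ∉ P) (hf : ∀ z : ℂ, z ∉ P → AnalyticAt ℂ f z) {σ₁ σ₀ : ℝ}
    (hreal : ∀ z : ℂ, ¬ AnalyticAt ℂ f z → σ₁ ≤ z.re → z.re ≤ σ₀ → z.im = 0 ∧ σ₁ < z.re ∧ z.re < σ₀) :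
    ∃ (S : Finset ℝ) (U : Set ℂ), (∀ c ∈ S, ¬ AnalyticAt ℂ f (c : ℂ) ∧ σ₁ < c ∧ c < σ₀) ∧ IsOpen U ∧ {z : ℂ | σ₁ ≤ z.re ∧ z.re ≤ σ₀} ⊆ U ∧
      DifferentiableOn ℂ f (U \ ((S.image fun c : ℝ => (c : ℂ)) : Set ℂ)) := by
  have hP'c : IsClosed {z : ℂ | ¬ AnalyticAt ℂ f z} := (isOpen_analyticAt ℂ f).isClosed_compl
  have hP'cd : ∀ z₀ : ℂ, ∀ᶠ s in 𝓝[≠] z₀, s ∉ {z : ℂ | ¬ AnalyticAt ℂ f z} := fun z₀ => (hPcd z₀).mono fun s hs hs' => hs' (hf s hs)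
  obtain ⟨S, hSP, -, hUo, hUs, hUP⟩ := exists_finset_real_poles_strip hP'c hP'cd (fun z hz h1 h2 => hreal z hz h1 h2)
  exact ⟨S, _, fun c hc => hSP c hc, hUo, hUs, fun z hz => (not_not.1 (hUP hz)).differentiableAt.differentiableWithinAt⟩

/-! ## §4 The half-strip `{½ ≤ Re ≤ σ₀}` of a self-dual scattering scalar: the axis is pole-free (★ p860080) -/

/-- **`hs` FOR A SELF-DUAL SCATTERING SCALAR ON `{½ ≤ Re ≤ σ₀}`**: `c` meromorphic in normal form on `ℂ` and analytic off a co-discrete `P`, with (FE) `c(z)c(1−z) = 1` and (conj)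
`c(conj z) = conj (c z)` off `P`, and every genuine pole with `½ < Re ≤ σ₀` REAL and `< σ₀` (the (d)-block) ⇒ a finset `S ⊂ (½, σ₀)` of real poles and an open `U ⊇ {½ ≤ Re ≤ σ₀}` with `c`
holomorphic on `U ∖ ↑S`; the axis `Re = ½` is pole-free by ★ `analyticAt_of_re_eq_half_of_fe_of_conj`. [cite: MoeglinWaldspurger1995, IV.1.11, IV.3.12] -/
theorem exists_finset_differentiableOn_halfStrip_of_fe_of_conj {c : ℂ → ℂ} {P : Set ℂ} (hcNF : MeromorphicNFOn c univ)
    (hPcd : ∀ z₀ : ℂ, ∀ᶠ w in 𝓝[≠] z₀, w ∉ P) (hc : ∀ z : ℂ, z ∉ P → AnalyticAt ℂ c z)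
    (hFE : ∀ z : ℂ, z ∉ P → 1 - z ∉ P → c z * c (1 - z) = 1) (hconj : ∀ z : ℂ, z ∉ P → conj z ∉ P → c (conj z) = conj (c z)) {σ₀ : ℝ}
    (hreal : ∀ z : ℂ, ¬ AnalyticAt ℂ c z → 1 / 2 < z.re → z.re ≤ σ₀ → z.im = 0 ∧ z.re < σ₀) :
    ∃ (S : Finset ℝ) (U : Set ℂ), (∀ x ∈ S, ¬ AnalyticAt ℂ c (x : ℂ) ∧ 1 / 2 < x ∧ x < σ₀) ∧ IsOpen U ∧ {z : ℂ | 1 / 2 ≤ z.re ∧ z.re ≤ σ₀} ⊆ U ∧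
      DifferentiableOn ℂ c (U \ ((S.image fun x : ℝ => (x : ℂ)) : Set ℂ)) := by
  refine exists_finset_differentiableOn_strip_of_singular hPcd hc fun z hz h1 h2 => ?_
  rcases lt_or_eq_of_le h1 with h | h
  · exact ⟨(hreal z hz h h2).1, h, (hreal z hz h h2).2⟩
  · exact absurd (analyticAt_of_re_eq_half_of_fe_of_conj hcNF hPcd hFE hconj h.symm) hz

end Summit.HodgeConjecture.HodgeConjecture.Cruxes.H413.K2E1MeromorphicStripFinitePoles

end
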